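import Summits.Ventures.PercRepro.RankLevelSetExplicitLin2KeyL

/-!
# PercRepro — THE LEVEL-12 THEOREM-M ROW OF C-025 (SHARP): THE KEY AT `p = 4 349` (p4, S4 feed)

`proofs/P4-gen18.md`. With THEOREM M's staircase multiplicity the assembled inequality `(P_d)` holds, exactly evaluated, at EVERY
core corank `13 ≤ d ≤ 4108` from `p = 2 135` (it fails at `p = 2 134`, corank `1 085`; the quartic floor is `8 764`, the
saturated one `40 204`). The row is taken at `p = 4 349` = the optimal-Chernoff tail (the least `p` with `16·n^n ≤ 2^n·(n − K)^{n−K}·K^K` at `n = p + D`, `K = 12 + D`, `D = 12 + 2^12`) of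
RankLevelSetExplicitLin2TailOptimal, which now binds: the key `KeyL 12 4349 d` (RankLevelSetExplicitLin2KeyL) is checked by the kernel at the
4 096 coranks (`decide`, 1 chunk of 4 096). The level step and the unconditional chain are
RankLevelSetExplicitLin2IndepFloorS (`c025_twelve_indepS_step`, `c025_twelve_indepS_from_4349`). Axioms: standard.
-/

namespace PercRepro

namespace ThmN

namespace Explicit

/-- **THE THEOREM-M KEY ROW AT `(q, p) = (12, 4 349)`**: `KeyL 12 4349 d` at every corank `13 ≤ d ≤ 4108`, by the kernel. -/
theorem key_twelve_indepS_row : ∀ t < 4096, KeyL 12 4349 (13 + t) := by decide +kernel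

end Explicit

end ThmN

end PercRepro
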